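import Literature.NumberTheory.ComplexMultiplication.CMOrderPEquivalenceLocalColon
import HarnessLib

/-!
# Invertible ideals with trivial extension to an over-order (MARSEGLIA 2025 LEMMA 6.6): `LT = T` iff every local
# generator of `L` is a unit of `T_𝔭`; local generators are determined up to `R_𝔭^×`; `L = R` iff all of them lie
# in `R_𝔭^×`; every finitely supported vector `(x_𝔭) ∈ ∏ T_𝔭^×` comes from such an `L`; and `T_𝔭 = R_𝔭` off `(R:T)`

Family `hodge`, lane `lit-hodgefound` (Track 2 foundations library; seat p15, row g26-#10), topic
`Literature/NumberTheory/ComplexMultiplication`, namespaces `Literature.NumberTheory.ComplexMultiplication.NumberRing`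
(§1–§2: any domain `R` with fraction field `K`; one-dimensional noetherian for the surjectivity) and `…EndOrder` (§3:
the order `𝔯 = endOrder ρ`).  THEOREMS ONLY: no definition, no instance, no named fact (net Literature debt `0`).
Conventions of `CMOrderInvertibleIdealLocalization` (g18-#1: `𝓘(R) ≅ ⊕_𝔭 𝓟(R_𝔭)`): `R_𝔭 = Localization.subalgebra.ofField
K 𝔭.primeCompl _ ⊆ K`, `I_𝔭 = span R_𝔭 ↑I`, a local generator of an invertible `L` at `𝔭` is `x` with `L_𝔭 = R_𝔭·x`;
an over-order `T` is an idempotent fractional ideal `M = MM ∋ 1`, `LT` is `L * M`, `(R:T) = 1 / M`; «`x ∈ T_𝔭^×`»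
is `x ∈ M_𝔭 ∧ x⁻¹ ∈ M_𝔭`.

## Source, VERBATIM

S. Marseglia, *Local isomorphism classes of fractional ideals of orders in étale algebras*, J. Algebra 673 (2025)
77–102 [Marseglia2025LocalIsomorphism] (arXiv:2311.18571, held `paper:arxiv-2311.18571`, chunk p0012):
"Lemma 6.6. Let `R ⊆ T` be orders. Consider the function `Φ : {invertible fractional R-ideals L such that LT = T}
⟶ ∏_𝔭 T_𝔭^× / R_𝔭^×`, `L ⟼ (x_𝔭 R_𝔭^×)_𝔭`, where `𝔭` runs over the maximal ideals of `R` and, for each `𝔭`, `x_𝔭`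
is a local generator of `L` at `𝔭`, that is, `L_𝔭 = x_𝔭R_𝔭`. Then `Φ` is a group isomorphism.
Proof. Let `L` be an invertible fractional `R`-ideal with `LT = T`. Firstly, if `𝔭` is a maximal ideal of `R` and
`L_𝔭 = x_𝔭R_𝔭` then `(LT)_𝔭 = T_𝔭` implies that `x_𝔭 ∈ T_𝔭^×`. Secondly, if `x_𝔭R_𝔭 = x′_𝔭R_𝔭` then `x′_𝔭 = ux_𝔭`
for some unit `u ∈ R_𝔭^×`, that is, the image `Φ(L)` does not depend on the choice of local generator `x_𝔭`.
Thirdly, observe that `Φ` is a group homomorphism. Fourthly, note that `L` is in the kernel of `Φ` if and only if,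
for every maximal ideal `𝔭`, the localization `L_𝔭` is generated by a unit in `R_𝔭^×`, that is, `L_𝔭 = R_𝔭`.
Hence `L = R`, that is, `Φ` is injective. Finally, we show that `Φ` is surjective. Let `(x_𝔭R_𝔭^×)_𝔭` be an element
of the codomain of `Φ`. For every maximal ideal `𝔭` not containing `(R:T)` we have that `T_𝔭 = R_𝔭`. This implies
that, for all but finitely many maximal ideals `𝔭`, we have `x_𝔭 ∈ R_𝔭^×`. Using an argument like in the proof of
Theorem 4.4 (cf. Equation (4.1)), we construct a fractional `R`-ideal `L` satisfying `L_𝔭 = x_𝔭R_𝔭` for every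
`𝔭 ⊇ (R:T)` and `L_𝔮 = R_𝔮` for every other maximal ideal `𝔮`. Such an ideal `L` is locally principal, hence
invertible, and since for every `𝔭` we have `x_𝔭 ∈ T_𝔭^×`, we get `LT = T`. □"

## What is formalised

* §1 (any domain): **`NumberRing.span_singleton_eq_span_singleton_iff`** («Secondly»: local generators differ by a
  unit of `R_𝔭`), `span_singleton_eq_span_one_of_mem_of_inv_mem`, **`mem_and_inv_mem_span_coe_of_mul_eq`**
  («Firstly»: `LT = T ⟹ x_𝔭 ∈ T_𝔭^×`), **`span_coe_mul_eq_of_mem_of_inv_mem`** (`x_𝔭 ∈ T_𝔭^× ⟹ (LT)_𝔭 = T_𝔭`),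
  **`mul_eq_iff_forall_exists_span_coe_eq`** (`LT = T ⟺ ∀ 𝔭, x_𝔭 ∈ T_𝔭^×`), **`eq_one_of_forall_mem_of_inv_mem`**
  («Fourthly»: the kernel of `Φ` is trivial), `span_coe_eq_span_one_of_not_one_div_le` («`T_𝔭 = R_𝔭` for `𝔭`
  not containing `(R:T)`»).
* §2 (one-dimensional noetherian domain): **`exists_isUnit_mul_eq_forall_span_coe_eq`** («Finally»: `Φ` is
  surjective — every finitely supported `(x_𝔭)` with `x_𝔭 ∈ T_𝔭^×` is the vector of local generators of an
  invertible `L` with `LT = T`).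
* §3 the same two statements for `𝔯 = endOrder ρ` (`EndOrder.mul_eq_iff_forall_exists_span_coe_eq`,
  `EndOrder.exists_isUnit_mul_eq_forall_span_coe_eq`).
-/

open scoped nonZeroDivisors NumberField
open Module FractionalIdeal NumberField

namespace Literature.NumberTheory.ComplexMultiplication

namespace NumberRing

/-! ## §1 Local generators and the condition `LT = T` -/

section AnyDomain

variable {R : Type*} [CommRing R] [IsDomain R] {K : Type*} [Field K] [Algebra R K] [IsFractionRing R K]

omit [IsDomain R] [IsFractionRing R K] in
/-- **«if `x_𝔭R_𝔭 = x′_𝔭R_𝔭` then `x′_𝔭 = ux_𝔭` for some unit `u ∈ R_𝔭^×`»**: two generators of the same cyclic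
`A`-submodule of `K` (`A ⊆ K` a subalgebra, `x ≠ 0`) differ by a unit of `A`, and conversely.
[cite: Marseglia2025LocalIsomorphism, §6, proof of Lemma 6.6 («Secondly»), p. 12] -/
theorem span_singleton_eq_span_singleton_iff (A : Subalgebra R K) {x y : K} (hx : x ≠ 0) :
    Submodule.span A {x} = Submodule.span A {y} ↔ ∃ u : A, IsUnit u ∧ y = (u : K) * x := by
  constructor
  · intro h
    obtain ⟨a, ha⟩ := Submodule.mem_span_singleton.1 (h ▸ Submodule.mem_span_singleton_self y :
      y ∈ Submodule.span A ({x} : Set K))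
    obtain ⟨b, hb⟩ := Submodule.mem_span_singleton.1 (h.symm ▸ Submodule.mem_span_singleton_self x :
      x ∈ Submodule.span A ({y} : Set K))
    rw [Subalgebra.smul_def, smul_eq_mul] at ha hb
    refine ⟨a, IsUnit.of_mul_eq_one b (Subtype.ext ?_), ha.symm⟩
    have hab : ((a : K) * b) * x = 1 * x := by rw [one_mul, mul_comm (a : K), mul_assoc, ha, hb]
    rw [Subalgebra.coe_mul, Subalgebra.coe_one]
    exact mul_right_cancel₀ hx hab
  · rintro ⟨u, hu, rfl⟩
    rw [← smul_eq_mul, ← Subalgebra.smul_def, Submodule.span_singleton_smul_eq hu]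

omit [IsDomain R] [IsFractionRing R K] in
/-- A unit of `A` generates `A·1`: `x, x⁻¹ ∈ A ⟹ A·x = A·1`. [cite: Marseglia2025LocalIsomorphism, §6, proof of
Lemma 6.6 («`L_𝔭` is generated by a unit in `R_𝔭^×`, that is, `L_𝔭 = R_𝔭`»), p. 12] -/
theorem span_singleton_eq_span_one_of_mem_of_inv_mem (A : Subalgebra R K) {x : K} (hx0 : x ≠ 0) (hx : x ∈ A)
    (hx' : x⁻¹ ∈ A) : Submodule.span A {x} = Submodule.span A {1} := by
  refine le_antisymm (Submodule.span_le.2 (Set.singleton_subset_iff.2 ?_))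
    (Submodule.span_le.2 (Set.singleton_subset_iff.2 ?_))
  · exact Submodule.mem_span_singleton.2 ⟨⟨x, hx⟩, by rw [Subalgebra.smul_def, smul_eq_mul, mul_one]⟩
  · exact Submodule.mem_span_singleton.2 ⟨⟨x⁻¹, hx'⟩, by
      rw [Subalgebra.smul_def, smul_eq_mul, inv_mul_cancel₀ hx0]⟩

/-- **«Firstly, if `L_𝔭 = x_𝔭R_𝔭` then `(LT)_𝔭 = T_𝔭` implies that `x_𝔭 ∈ T_𝔭^×`»**: for fractional ideals `L`,
`T = M ∋ 1` with `LM = M` and a local generator `x` of `L` at `𝔭`, both `x` and `x⁻¹` lie in `M_𝔭`.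
[cite: Marseglia2025LocalIsomorphism, §6, proof of Lemma 6.6 («Firstly»), p. 12] -/
theorem mem_and_inv_mem_span_coe_of_mul_eq {L M : FractionalIdeal R⁰ K} (h1 : (1 : K) ∈ M) (hLM : L * M = M)
    (𝔭 : Ideal R) [𝔭.IsPrime] {x : K}
    (hL : Submodule.span (Localization.subalgebra.ofField K 𝔭.primeCompl 𝔭.primeCompl_le_nonZeroDivisors)
        (L : Set K) =
      Submodule.span (Localization.subalgebra.ofField K 𝔭.primeCompl 𝔭.primeCompl_le_nonZeroDivisors) {x}) :
    x ∈ Submodule.span (Localization.subalgebra.ofField K 𝔭.primeCompl 𝔭.primeCompl_le_nonZeroDivisors)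
        (M : Set K) ∧
      x⁻¹ ∈ Submodule.span (Localization.subalgebra.ofField K 𝔭.primeCompl 𝔭.primeCompl_le_nonZeroDivisors)
        (M : Set K) := by
  set A := Localization.subalgebra.ofField K 𝔭.primeCompl 𝔭.primeCompl_le_nonZeroDivisors with hA
  -- `x·M_𝔭 = (LM)_𝔭 = M_𝔭`
  have key : Submodule.span A {x} * Submodule.span A (M : Set K) = Submodule.span A (M : Set K) := by
    rw [← hL, ← span_coe_mul, hLM]
  have h1' : (1 : K) ∈ Submodule.span A (M : Set K) := Submodule.subset_span h1
  have hx0 : x ≠ 0 := by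
    rintro rfl
    rw [Submodule.span_singleton_eq_bot.2 rfl, Submodule.bot_mul] at key
    exact one_ne_zero ((Submodule.mem_bot _).1 (key ▸ h1' : (1 : K) ∈ (⊥ : Submodule A K)))
  constructor
  · have h := Submodule.mul_mem_mul (Submodule.mem_span_singleton_self x) h1'
    rwa [mul_one, key] at h
  · have h := (mem_span_singleton_mul_iff A hx0 _ 1).1 (key.symm ▸ h1')
    rwa [mul_one] at h

/-- **Conversely `x_𝔭 ∈ T_𝔭^× ⟹ (LT)_𝔭 = x_𝔭T_𝔭 = T_𝔭`** (`T = M = MM`).  [cite: Marseglia2025LocalIsomorphism, §6,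
proof of Lemma 6.6 («since for every `𝔭` we have `x_𝔭 ∈ T_𝔭^×`, we get `LT = T`»), p. 12] -/
theorem span_coe_mul_eq_of_mem_of_inv_mem {L M : FractionalIdeal R⁰ K} (hMM : M * M = M) (𝔭 : Ideal R)
    [𝔭.IsPrime] {x : K} (hx0 : x ≠ 0)
    (hL : Submodule.span (Localization.subalgebra.ofField K 𝔭.primeCompl 𝔭.primeCompl_le_nonZeroDivisors)
        (L : Set K) =
      Submodule.span (Localization.subalgebra.ofField K 𝔭.primeCompl 𝔭.primeCompl_le_nonZeroDivisors) {x})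
    (hxM : x ∈ Submodule.span (Localization.subalgebra.ofField K 𝔭.primeCompl 𝔭.primeCompl_le_nonZeroDivisors)
      (M : Set K))
    (hx'M : x⁻¹ ∈ Submodule.span (Localization.subalgebra.ofField K 𝔭.primeCompl 𝔭.primeCompl_le_nonZeroDivisors)
      (M : Set K)) :
    Submodule.span (Localization.subalgebra.ofField K 𝔭.primeCompl 𝔭.primeCompl_le_nonZeroDivisors)
        ((L * M : FractionalIdeal R⁰ K) : Set K) =
      Submodule.span (Localization.subalgebra.ofField K 𝔭.primeCompl 𝔭.primeCompl_le_nonZeroDivisors)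
        (M : Set K) := by
  set A := Localization.subalgebra.ofField K 𝔭.primeCompl 𝔭.primeCompl_le_nonZeroDivisors with hA
  have hMM' : Submodule.span A (M : Set K) * Submodule.span A (M : Set K) = Submodule.span A (M : Set K) := by
    rw [← span_coe_mul, hMM]
  rw [span_coe_mul, hL]
  refine le_antisymm ?_ fun y hy ↦ ?_
  · calc Submodule.span A {x} * Submodule.span A (M : Set K)
        ≤ Submodule.span A (M : Set K) * Submodule.span A (M : Set K) :=
          mul_le_mul' (Submodule.span_le.2 (Set.singleton_subset_iff.2 hxM)) le_rfl
      _ = Submodule.span A (M : Set K) := hMM'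
  · rw [mem_span_singleton_mul_iff A hx0]
    exact hMM'.le (Submodule.mul_mem_mul hx'M hy)

/-- **LEMMA 6.6, the set on the left: an invertible `L` has `LT = T` iff EVERY local generator is a unit of `T_𝔭`,
iff at every maximal `𝔭` SOME local generator `x_𝔭` has `x_𝔭, x_𝔭⁻¹ ∈ T_𝔭`** (`T = M = MM ∋ 1`; (4-3)).
[cite: Marseglia2025LocalIsomorphism, §6 Lemma 6.6 (proof, «Firstly» and «Finally»), p. 12]
[cite: Stevenhagen2008NumberRings, §4 (4-3), p. 217] -/
theorem mul_eq_iff_forall_exists_span_coe_eq {L M : FractionalIdeal R⁰ K} (hL : IsUnit L) (hMM : M * M = M)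
    (h1 : (1 : K) ∈ M) :
    L * M = M ↔ ∀ 𝔭 : MaximalSpectrum R, ∃ x : K, x ≠ 0 ∧
      Submodule.span (Localization.subalgebra.ofField K 𝔭.asIdeal.primeCompl
          𝔭.asIdeal.primeCompl_le_nonZeroDivisors) (L : Set K) =
        Submodule.span (Localization.subalgebra.ofField K 𝔭.asIdeal.primeCompl
          𝔭.asIdeal.primeCompl_le_nonZeroDivisors) {x} ∧
      x ∈ Submodule.span (Localization.subalgebra.ofField K 𝔭.asIdeal.primeCompl
          𝔭.asIdeal.primeCompl_le_nonZeroDivisors) (M : Set K) ∧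
      x⁻¹ ∈ Submodule.span (Localization.subalgebra.ofField K 𝔭.asIdeal.primeCompl
          𝔭.asIdeal.primeCompl_le_nonZeroDivisors) (M : Set K) := by
  constructor
  · intro hLM 𝔭
    haveI := 𝔭.isMaximal.isPrime
    obtain ⟨x, -, hx0, hx⟩ := exists_ne_zero_span_coe_eq_span_singleton hL 𝔭.asIdeal
    exact ⟨x, hx0, hx, mem_and_inv_mem_span_coe_of_mul_eq h1 hLM 𝔭.asIdeal hx⟩
  · intro h
    refine eq_iff_forall_span_coe_eq.2 fun 𝔭 ↦ ?_
    haveI := 𝔭.isMaximal.isPrime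
    obtain ⟨x, hx0, hx, hxM, hx'M⟩ := h 𝔭
    exact span_coe_mul_eq_of_mem_of_inv_mem hMM 𝔭.asIdeal hx0 hx hxM hx'M

/-- **«Fourthly … `L` is in the kernel of `Φ` iff, for every maximal ideal `𝔭`, `L_𝔭` is generated by a unit in
`R_𝔭^×`, that is, `L_𝔭 = R_𝔭`. Hence `L = R`»**: if at every maximal `𝔭` some local generator of `L` is a unit of
`R_𝔭`, then `L = 1`. [cite: Marseglia2025LocalIsomorphism, §6, proof of Lemma 6.6 («Fourthly»), p. 12]
[cite: NeukirchANT1999, Ch. I §12, proof of Prop. (12.6) (injectivity), p. 76] -/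
theorem eq_one_of_forall_mem_of_inv_mem {L : FractionalIdeal R⁰ K}
    (h : ∀ 𝔭 : MaximalSpectrum R, ∃ x : K, x ≠ 0 ∧
      Submodule.span (Localization.subalgebra.ofField K 𝔭.asIdeal.primeCompl
          𝔭.asIdeal.primeCompl_le_nonZeroDivisors) (L : Set K) =
        Submodule.span (Localization.subalgebra.ofField K 𝔭.asIdeal.primeCompl
          𝔭.asIdeal.primeCompl_le_nonZeroDivisors) {x} ∧
      x ∈ Localization.subalgebra.ofField K 𝔭.asIdeal.primeCompl 𝔭.asIdeal.primeCompl_le_nonZeroDivisors ∧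
      x⁻¹ ∈ Localization.subalgebra.ofField K 𝔭.asIdeal.primeCompl 𝔭.asIdeal.primeCompl_le_nonZeroDivisors) :
    L = 1 := by
  refine eq_one_of_forall_span_coe_eq_span_one fun 𝔭 ↦ ?_
  obtain ⟨x, hx0, hx, hxA, hx'A⟩ := h 𝔭
  rw [hx, span_singleton_eq_span_one_of_mem_of_inv_mem _ hx0 hxA hx'A]

/-- **«For every maximal ideal `𝔭` not containing `(R:T)` we have that `T_𝔭 = R_𝔭`»** (`T = M ∋ 1`, `(R:T) = 1 / M`;
some `u ∈ (R:T) ∖ 𝔭` is a unit of `R_𝔭` with `uT ⊆ R`). [cite: Marseglia2025LocalIsomorphism, §6, proof of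
Lemma 6.6 («Finally»), p. 12] -/
theorem span_coe_eq_span_one_of_not_one_div_le {M : FractionalIdeal R⁰ K} (h1 : (1 : K) ∈ M) (𝔭 : Ideal R)
    [h𝔭 : 𝔭.IsPrime] (h : ¬ 1 / M ≤ (𝔭 : FractionalIdeal R⁰ K)) :
    Submodule.span (Localization.subalgebra.ofField K 𝔭.primeCompl 𝔭.primeCompl_le_nonZeroDivisors) (M : Set K) =
      Submodule.span (Localization.subalgebra.ofField K 𝔭.primeCompl 𝔭.primeCompl_le_nonZeroDivisors) {1} := by
  set A := Localization.subalgebra.ofField K 𝔭.primeCompl 𝔭.primeCompl_le_nonZeroDivisors with hA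
  have hM0 : M ≠ 0 := by rintro rfl; exact one_ne_zero ((mem_zero_iff R⁰).1 h1)
  -- `(R:T) ⊆ R` is an ideal `𝔞 ⊄ 𝔭`; pick `u ∈ 𝔞 ∖ 𝔭`
  have hle1 : 1 / M ≤ (1 : FractionalIdeal R⁰ K) := fun y hy ↦ by
    have h := (mem_div_iff_of_ne_zero hM0).1 hy 1 h1
    rwa [mul_one] at h
  obtain ⟨𝔞, h𝔞⟩ := le_one_iff_exists_coeIdeal.1 hle1
  have h𝔞𝔭 : ¬ 𝔞 ≤ 𝔭 := fun hle ↦ h (by rw [← h𝔞]; exact (coeIdeal_le_coeIdeal K).2 hle)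
  obtain ⟨u, hu𝔞, hu𝔭⟩ := Set.not_subset.1 h𝔞𝔭
  have hu : algebraMap R K u ∈ 1 / M := h𝔞 ▸ (mem_coeIdeal R⁰).2 ⟨u, hu𝔞, rfl⟩
  -- `u⁻¹ ∈ R_𝔭`
  have huA : (algebraMap R K u)⁻¹ ∈ A := by
    have h1u : (1 : K) ∈ Submodule.span A ({algebraMap R K u} : Set K) := by
      rw [span_singleton_algebraMap_eq_span_one (K := K) hu𝔭]; exact Submodule.mem_span_singleton_self _
    obtain ⟨a, ha⟩ := Submodule.mem_span_singleton.1 h1u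
    rw [Subalgebra.smul_def, smul_eq_mul] at ha
    rw [inv_eq_of_mul_eq_one_left ha]
    exact a.2
  refine le_antisymm (Submodule.span_le.2 fun m hm ↦ ?_)
    (Submodule.span_mono (Set.singleton_subset_iff.2 h1))
  -- `m = u⁻¹·(um)` with `um ∈ R`
  obtain ⟨r, hr⟩ := (mem_one_iff R⁰).1 ((mem_div_iff_of_ne_zero hM0).1 hu m hm)
  rw [SetLike.mem_coe, Submodule.mem_span_singleton]
  refine ⟨⟨(algebraMap R K u)⁻¹ * algebraMap R K r, mul_mem huA (A.algebraMap_mem r)⟩, ?_⟩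
  have hu0 : algebraMap R K u ≠ 0 := fun h0 ↦ hu𝔭 (by
    rw [(IsFractionRing.injective R K) (h0.trans (map_zero _).symm)]; exact 𝔭.zero_mem)
  rw [Subalgebra.smul_def, smul_eq_mul, mul_one]
  change (algebraMap R K u)⁻¹ * algebraMap R K r = m
  rw [hr, ← mul_assoc, inv_mul_cancel₀ hu0, one_mul]

end AnyDomain

/-! ## §2 Surjectivity of `Φ`: every finitely supported `(x_𝔭) ∈ ∏ T_𝔭^×` is a vector of local generators -/

section Surjective

variable {R : Type*} [CommRing R] [IsDomain R] {K : Type*} [Field K] [Algebra R K] [IsFractionRing R K]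
variable [IsNoetherianRing R] [Ring.DimensionLEOne R]

/-- **LEMMA 6.6, «Finally, we show that `Φ` is surjective»**: for a finite set `F` of maximal ideals and
`x_𝔭 ∈ T_𝔭^×` (`𝔭 ∈ F`), there is an INVERTIBLE `L` with `LT = T`, `L_𝔭 = x_𝔭R_𝔭` on `F` and `L_𝔮 = R_𝔮` off `F`
(`T = M = MM ∋ 1`; `L` from `CMOrderInvertibleIdealLocalization.exists_isUnit_forall_span_coe_eq`, the eq. (4.1)
construction). [cite: Marseglia2025LocalIsomorphism, §6 Lemma 6.6 («Finally»), p. 12]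
[cite: Stevenhagen2008NumberRings, §5 Thm. 5.3, p. 219] -/
theorem exists_isUnit_mul_eq_forall_span_coe_eq {M : FractionalIdeal R⁰ K} (hMM : M * M = M) (h1 : (1 : K) ∈ M)
    (F : Finset (MaximalSpectrum R)) (x : MaximalSpectrum R → K) (hx0 : ∀ 𝔭 ∈ F, x 𝔭 ≠ 0)
    (hxM : ∀ 𝔭 ∈ F,
      x 𝔭 ∈ Submodule.span (Localization.subalgebra.ofField K 𝔭.asIdeal.primeCompl
          𝔭.asIdeal.primeCompl_le_nonZeroDivisors) (M : Set K) ∧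
      (x 𝔭)⁻¹ ∈ Submodule.span (Localization.subalgebra.ofField K 𝔭.asIdeal.primeCompl
          𝔭.asIdeal.primeCompl_le_nonZeroDivisors) (M : Set K)) :
    ∃ L : FractionalIdeal R⁰ K, IsUnit L ∧ L * M = M ∧
      (∀ 𝔭 ∈ F, Submodule.span (Localization.subalgebra.ofField K 𝔭.asIdeal.primeCompl
          𝔭.asIdeal.primeCompl_le_nonZeroDivisors) (L : Set K) =
        Submodule.span (Localization.subalgebra.ofField K 𝔭.asIdeal.primeCompl
          𝔭.asIdeal.primeCompl_le_nonZeroDivisors) {x 𝔭}) ∧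
      ∀ 𝔭 ∉ F, Submodule.span (Localization.subalgebra.ofField K 𝔭.asIdeal.primeCompl
          𝔭.asIdeal.primeCompl_le_nonZeroDivisors) (L : Set K) =
        Submodule.span (Localization.subalgebra.ofField K 𝔭.asIdeal.primeCompl
          𝔭.asIdeal.primeCompl_le_nonZeroDivisors) {1} := by
  obtain ⟨L, hL, hF, hF'⟩ := exists_isUnit_forall_span_coe_eq F x hx0
  refine ⟨L, hL, (mul_eq_iff_forall_exists_span_coe_eq hL hMM h1).2 fun 𝔭 ↦ ?_, hF, hF'⟩
  by_cases h𝔭 : 𝔭 ∈ F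
  · exact ⟨x 𝔭, hx0 𝔭 h𝔭, hF 𝔭 h𝔭, hxM 𝔭 h𝔭⟩
  · refine ⟨1, one_ne_zero, hF' 𝔭 h𝔭, Submodule.subset_span h1, ?_⟩
    rw [inv_one]; exact Submodule.subset_span h1

end Surjective

end NumberRing

/-! ## §3 The order `𝔯 = endOrder ρ` -/

namespace EndOrder

variable {K : Type} [Field K] [NumberField K]
variable {ι : Type} [Fintype ι] [DecidableEq ι] [Nonempty ι] {ρ : K →ₐ[ℚ] Matrix ι ι ℚ}
variable [IsFractionRing (endOrder ρ) K]

/-- **LEMMA 6.6 for the order `𝔯 = endOrder ρ` and an over-order `T = M = MM ≠ 0`: an invertible `L` has `LT = T`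
iff at every maximal `𝔭` a local generator `x_𝔭` of `L` is a unit of `T_𝔭`.**
[cite: Marseglia2025LocalIsomorphism, §6 Lemma 6.6, p. 12] -/
theorem mul_eq_iff_forall_exists_span_coe_eq {L M : FractionalIdeal (endOrder ρ)⁰ K} (hL : IsUnit L)
    (hMM : M * M = M) (hM0 : M ≠ 0) :
    L * M = M ↔ ∀ 𝔭 : MaximalSpectrum (endOrder ρ), ∃ x : K, x ≠ 0 ∧
      Submodule.span (Localization.subalgebra.ofField K 𝔭.asIdeal.primeCompl
          𝔭.asIdeal.primeCompl_le_nonZeroDivisors) (L : Set K) =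
        Submodule.span (Localization.subalgebra.ofField K 𝔭.asIdeal.primeCompl
          𝔭.asIdeal.primeCompl_le_nonZeroDivisors) {x} ∧
      x ∈ Submodule.span (Localization.subalgebra.ofField K 𝔭.asIdeal.primeCompl
          𝔭.asIdeal.primeCompl_le_nonZeroDivisors) (M : Set K) ∧
      x⁻¹ ∈ Submodule.span (Localization.subalgebra.ofField K 𝔭.asIdeal.primeCompl
          𝔭.asIdeal.primeCompl_le_nonZeroDivisors) (M : Set K) :=
  haveI := CMTypeLattice.isNoetherianRing_endOrder ρ
  NumberRing.mul_eq_iff_forall_exists_span_coe_eq hL hMM (FractionalIdeal.one_le.1 (one_le_of_mul_self_eq hMM hM0))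

/-- **LEMMA 6.6 for `𝔯 = endOrder ρ`, surjectivity of `Φ`: every finitely supported vector `(x_𝔭)`, `x_𝔭 ∈ T_𝔭^×`,
is the vector of local generators of an invertible `L` with `LT = T`.** [cite: Marseglia2025LocalIsomorphism, §6
Lemma 6.6 («Finally»), p. 12] -/
theorem exists_isUnit_mul_eq_forall_span_coe_eq {M : FractionalIdeal (endOrder ρ)⁰ K} (hMM : M * M = M)
    (hM0 : M ≠ 0) (F : Finset (MaximalSpectrum (endOrder ρ))) (x : MaximalSpectrum (endOrder ρ) → K)
    (hx0 : ∀ 𝔭 ∈ F, x 𝔭 ≠ 0)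
    (hxM : ∀ 𝔭 ∈ F,
      x 𝔭 ∈ Submodule.span (Localization.subalgebra.ofField K 𝔭.asIdeal.primeCompl
          𝔭.asIdeal.primeCompl_le_nonZeroDivisors) (M : Set K) ∧
      (x 𝔭)⁻¹ ∈ Submodule.span (Localization.subalgebra.ofField K 𝔭.asIdeal.primeCompl
          𝔭.asIdeal.primeCompl_le_nonZeroDivisors) (M : Set K)) :
    ∃ L : FractionalIdeal (endOrder ρ)⁰ K, IsUnit L ∧ L * M = M ∧
      (∀ 𝔭 ∈ F, Submodule.span (Localization.subalgebra.ofField K 𝔭.asIdeal.primeCompl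
          𝔭.asIdeal.primeCompl_le_nonZeroDivisors) (L : Set K) =
        Submodule.span (Localization.subalgebra.ofField K 𝔭.asIdeal.primeCompl
          𝔭.asIdeal.primeCompl_le_nonZeroDivisors) {x 𝔭}) ∧
      ∀ 𝔭 ∉ F, Submodule.span (Localization.subalgebra.ofField K 𝔭.asIdeal.primeCompl
          𝔭.asIdeal.primeCompl_le_nonZeroDivisors) (L : Set K) =
        Submodule.span (Localization.subalgebra.ofField K 𝔭.asIdeal.primeCompl
          𝔭.asIdeal.primeCompl_le_nonZeroDivisors) {1} :=
  haveI := CMTypeLattice.isNoetherianRing_endOrder ρ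
  haveI := CMTypeLattice.dimensionLEOne_endOrder ρ
  NumberRing.exists_isUnit_mul_eq_forall_span_coe_eq hMM (FractionalIdeal.one_le.1 (one_le_of_mul_self_eq hMM hM0))
    F x hx0 hxM

end EndOrder

end Literature.NumberTheory.ComplexMultiplication
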